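import Mathlib
import Summits.ResolutionOfSingularities.ResolutionOfSingularities.Theorems.WeightedInvariantLocalWeightedDropMonicDescentTailStabilise
import Summits.ResolutionOfSingularities.ResolutionOfSingularities.Theorems.WeightedInvariantLocalWeightedDropMonicDescentTailTools
import Summits.ResolutionOfSingularities.ResolutionOfSingularities.Theorems.WeightedInvariantLocalWeightedDropMonicDescentWPUnique
import Summits.ResolutionOfSingularities.ResolutionOfSingularities.Theorems.WeightedInvariantLocalWeightedDropMonicDescentShearRecentre
import Summits.ResolutionOfSingularities.ResolutionOfSingularities.Theorems.WeightedInvariantLocalWeightedDropMonicDescentPrepInvarianceRow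

/-!
# `WeightedInvariant.LocalWeightedDrop`, sub-stub N4″: bookkeeping of a β-neutral Σ**-chain — point steps, parameters, the limit shear (T-5′ step (s2))

Crux item stmt-ResolutionOfSingularities-8899 `LocalWeightedDrop` (route `ResolutionOfSingularities/WeightedInvariant`), door
`WeightedConstruction` stmt-ResolutionOfSingularities-0571.  [OURS · L1 W4.3, chain w43, lead prover; piece T-5′ of `N4PRIME-PLAN.md` (§9).  MODEL:
Cossart–Jannsen–Saito LNM 2270 Thm 13.7 with Claim 13.8: along an infinite chain with constant `β`, straighten all future centres at once by the limit
coordinate `v = u₂ + Σ λ_q u₁^{q+1}`, then `ε` is constant `< 1` and `ζ` drops at every step.]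

This file: the bookkeeping of a β-neutral chain — point steps vs. `V(y,u₁)`-steps, the parameters `λ_m`, infinitely many point steps
(`2α` drops by 2 at each `V(y,u₁)`-step), the index `ptIdx m i` of the `i`-th point step after `m`, and the LIMIT SHEAR `hser m` (the power series in
`u₁` whose `i`-th coefficient is the parameter of the `i`-th point step after `m`) with its two relations
`hser m = C (λ m) + u₁ · hser (m+1)` (point step) and `hser (m+1) = hser m` (curve step).
-/

set_option linter.dupNamespace false -- mandated namespace of this single-conjunct summit

noncomputable section

namespace Summit.ResolutionOfSingularities.ResolutionOfSingularities.Theorems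

namespace MonicDescent

open MvPowerSeries Literature.RingTheory.TwoVariableSeries

attribute [local instance] Classical.propDecidable

variable {k : Type} [Field k]

section Tail

variable (A : ℕ → Label k)
  (hA : ∀ m, WellPrepared (A m).1 (A m).2 ∧ IsPosition (A m).1 (A m).2 ∧ ¬ IsDoublePlane (A m).1 (A m).2 ∧
    IsNeutralStep (A m) (A (m + 1)))

/-- A POINT STEP of the neutral chain: `V(y,u₁)` is not permissible at `A m` (so the step is a point blow-up answered by `(1:λ)`). -/
def IsPointStep (m : ℕ) : Prop := ¬ IsPermissibleOne (A m).1 (A m).2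

include hA in
/-- At a curve step the next label is `A m / (u₁², u₁)`. -/
theorem succ_eq_divOneLabel {m : ℕ} (hm : ¬ IsPointStep A m) : A (m + 1) = divOneLabel (A m) := by
  unfold IsPointStep at hm
  push Not at hm
  rcases (hA m).2.2.2 with ⟨-, h⟩ | ⟨h1, -⟩
  · exact h
  · exact absurd hm h1

include hA in
/-- At a point step: no axis curve, no graph curve, and the next label is `blowOneLabel (A m)` or `blowOneLabel (prep (shearLabel (C c) (A m)))`. -/
theorem pointStep_cases {m : ℕ} (hm : IsPointStep A m) :
    ¬ IsPermissibleOne (A m).1 (A m).2 ∧ ¬ IsPermissibleTwo (A m).1 (A m).2 ∧ ¬ HasGraphCurve (A m) ∧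
      ∃ c : k, (c = 0 ∧ A (m + 1) = blowOneLabel (A m)) ∨ (c ≠ 0 ∧ A (m + 1) = blowOneLabel (prep (shearLabel (C c) (A m)))) := by
  rcases (hA m).2.2.2 with ⟨h1, -⟩ | ⟨h1, h2, h3, h⟩
  · exact absurd h1 hm
  · refine ⟨h1, h2, h3, ?_⟩
    rcases h with h | ⟨c, hc, h⟩
    · exact ⟨0, Or.inl ⟨rfl, h⟩⟩
    · exact ⟨c, Or.inr ⟨hc, h⟩⟩

/-- The PARAMETER `λ_m` of step `m`: the `c` of a `(1:c)` point step, `0` otherwise. -/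
def param (m : ℕ) : k :=
  if h : IsPointStep A m ∧ ∃ c : k, c ≠ 0 ∧ A (m + 1) = blowOneLabel (prep (shearLabel (C c) (A m))) then Classical.choose h.2 else 0

include hA in
/-- `2α` drops by exactly 2 at a curve step. -/
theorem alphaL_succ_of_not_isPointStep {m : ℕ} (hm : ¬ IsPointStep A m) :
    alphaL (newtonSet (A (m + 1)).1 (A (m + 1)).2) + 2 = alphaL (newtonSet (A m).1 (A m).2) := by
  have hP1 : IsPermissibleOne (A m).1 (A m).2 := by unfold IsPointStep at hm; push Not at hm; exact hm
  have hfst := two_le_fst_of_isPermissibleOne hP1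
  have hne := newtonSet_nonempty_of_not_isDoublePlane (hA m).2.2.1
  rw [succ_eq_divOneLabel A hA hm]
  have hN : newtonSet (divOneLabel (A m)).1 (divOneLabel (A m)).2 = shiftOne '' newtonSet (A m).1 (A m).2 :=
    newtonSet_divOne _ _ hfst
  rw [hN, alphaL_image_shiftOne hne]
  obtain ⟨P, hP, hP0⟩ := exists_eq_alphaL hne
  have := hfst P hP
  omega

include hA in
/-- INFINITELY MANY POINT STEPS: after every `m` there is a point step (a run of curve steps lowers `2α` by 2 each time). -/
theorem exists_isPointStep_ge (m : ℕ) : ∃ n, m ≤ n ∧ IsPointStep A n := by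
  by_contra h
  push Not at h
  -- `α(A (m + j)) + 2j = α(A m)` for all `j`
  have hdec : ∀ j, alphaL (newtonSet (A (m + j)).1 (A (m + j)).2) + 2 * j = alphaL (newtonSet (A m).1 (A m).2) := by
    intro j
    induction j with
    | zero => simp
    | succ j ih =>
      have hstep := alphaL_succ_of_not_isPointStep A hA (h (m + j) (by omega))
      rw [show m + (j + 1) = m + j + 1 from by omega]
      omega
  have := hdec (alphaL (newtonSet (A m).1 (A m).2) + 1)
  omega

/-- The index of the `i`-th point step at or after `m`. -/
def ptIdx (m : ℕ) (hex : ∀ m, ∃ n, m ≤ n ∧ IsPointStep A n) : ℕ → ℕ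
  | 0 => Nat.find (hex m)
  | i + 1 => Nat.find (hex (ptIdx m hex i + 1))

section PtIdx

variable (hex : ∀ m, ∃ n, m ≤ n ∧ IsPointStep A n)

/-- `ptIdx m 0` is a point step `≥ m`, and the least such. -/
theorem ptIdx_zero_spec (m : ℕ) : m ≤ ptIdx A m hex 0 ∧ IsPointStep A (ptIdx A m hex 0) ∧
    ∀ n, m ≤ n → IsPointStep A n → ptIdx A m hex 0 ≤ n := by
  refine ⟨(Nat.find_spec (hex m)).1, (Nat.find_spec (hex m)).2, fun n hmn hn => ?_⟩
  exact Nat.find_min' (hex m) ⟨hmn, hn⟩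

/-- At a point step `m`: the `0`-th point step after `m` is `m` itself. -/
theorem ptIdx_zero_of_isPointStep {m : ℕ} (hm : IsPointStep A m) : ptIdx A m hex 0 = m :=
  le_antisymm ((ptIdx_zero_spec A hex m).2.2 m le_rfl hm) (ptIdx_zero_spec A hex m).1

/-- At a curve step `m`: the point steps after `m` are those after `m + 1`. -/
theorem ptIdx_zero_of_not_isPointStep {m : ℕ} (hm : ¬ IsPointStep A m) : ptIdx A m hex 0 = ptIdx A (m + 1) hex 0 := by
  apply le_antisymm
  · exact (ptIdx_zero_spec A hex m).2.2 _ (by have := (ptIdx_zero_spec A hex (m + 1)).1; omega) (ptIdx_zero_spec A hex (m + 1)).2.1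
  · refine (ptIdx_zero_spec A hex (m + 1)).2.2 _ ?_ (ptIdx_zero_spec A hex m).2.1
    have h1 := (ptIdx_zero_spec A hex m).1
    rcases Nat.eq_or_lt_of_le h1 with h | h
    · exact absurd (h ▸ (ptIdx_zero_spec A hex m).2.1) hm
    · omega

/-- Shift of the point-step index at a point step: the `(i+1)`-th point step after `m` is the `i`-th after `m + 1`. -/
theorem ptIdx_succ_of_isPointStep {m : ℕ} (hm : IsPointStep A m) (i : ℕ) : ptIdx A m hex (i + 1) = ptIdx A (m + 1) hex i := by
  induction i with
  | zero =>
    show Nat.find (hex (ptIdx A m hex 0 + 1)) = ptIdx A (m + 1) hex 0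
    rw [ptIdx_zero_of_isPointStep A hex hm]
    rfl
  | succ i ih =>
    show Nat.find (hex (ptIdx A m hex (i + 1) + 1)) = Nat.find (hex (ptIdx A (m + 1) hex i + 1))
    rw [ih]

/-- Shift of the point-step index at a curve step. -/
theorem ptIdx_of_not_isPointStep {m : ℕ} (hm : ¬ IsPointStep A m) (i : ℕ) : ptIdx A m hex i = ptIdx A (m + 1) hex i := by
  induction i with
  | zero => exact ptIdx_zero_of_not_isPointStep A hex hm
  | succ i ih =>
    show Nat.find (hex (ptIdx A m hex i + 1)) = Nat.find (hex (ptIdx A (m + 1) hex i + 1))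
    rw [ih]

/-- THE LIMIT SHEAR at time `m`: the series in `u₁` whose coefficient of `u₁^i` is the parameter of the `i`-th point step after `m`
(CJS's `v = u₂ + Σ λ_q u₁^{q+1}`, read from time `m` on). -/
def hser (m : ℕ) : MvPowerSeries (Fin 2) k :=
  fun e => if e 1 = 0 then param A (ptIdx A m hex (e 0)) else 0

/-- Coefficients of the limit shear. -/
theorem coeff_hser (m : ℕ) (e : Fin 2 →₀ ℕ) :
    coeff e (hser A hex m) = if e 1 = 0 then param A (ptIdx A m hex (e 0)) else 0 := rfl

/-- The limit shear is a series in `u₁` only. -/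
theorem hser_noY (m : ℕ) : ∀ e : Fin 2 →₀ ℕ, e 1 ≠ 0 → coeff e (hser A hex m) = 0 := by
  intro e he
  rw [coeff_hser, if_neg he]

/-- POINT-STEP RELATION: `hser m = C (λ m) + u₁ · hser (m+1)`. -/
theorem hser_of_isPointStep {m : ℕ} (hm : IsPointStep A m) : hser A hex m = C (param A m) + X 0 * hser A hex (m + 1) := by
  ext e
  rw [coeff_hser, map_add, coeff_C, show (X 0 : MvPowerSeries (Fin 2) k) = monomial (Finsupp.single 0 1) 1 from X_def 0,
    coeff_monomial_mul]
  by_cases he1 : e 1 = 0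
  · rw [if_pos he1]
    by_cases he0 : e 0 = 0
    · have he : e = 0 := finsupp_fin2_ext (by simpa using he0) (by simpa using he1)
      subst he
      simp only [Finsupp.coe_zero, Pi.zero_apply, ptIdx_zero_of_isPointStep A hex hm, if_true]
      rw [if_neg (by intro h; have := h 0; simp at this), add_zero]
    · rw [if_neg (by intro h; exact he0 (by rw [h]; rfl)), zero_add, if_pos (by intro i; fin_cases i <;> simp; omega), one_mul,
        coeff_hser, if_pos (by simpa using he1)]
      have : (e - Finsupp.single 0 1 : Fin 2 →₀ ℕ) 0 = e 0 - 1 := by simp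
      rw [this]
      obtain ⟨j, hj⟩ : ∃ j, e 0 = j + 1 := ⟨e 0 - 1, by omega⟩
      rw [hj, ptIdx_succ_of_isPointStep A hex hm j]
      simp
  · rw [if_neg he1, if_neg (by intro h; apply he1; rw [h]; rfl), zero_add]
    split_ifs with hle
    · rw [coeff_hser, if_neg (by simpa using he1), mul_zero]
    · rfl

/-- CURVE-STEP RELATION: `hser (m+1) = hser m`. -/
theorem hser_of_not_isPointStep {m : ℕ} (hm : ¬ IsPointStep A m) : hser A hex (m + 1) = hser A hex m := by
  ext e
  rw [coeff_hser, coeff_hser]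
  split_ifs
  · rw [ptIdx_of_not_isPointStep A hex hm]
  · rfl

end PtIdx

end Tail

end MonicDescent

end Summit.ResolutionOfSingularities.ResolutionOfSingularities.Theorems

end
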